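import Literature.Claims.NS.Chebiam2025
import HarnessLib

/-!
# C126 `Chebiam2025` — the datum class `T¹₄(Ω) ∩ V` of Theorem 6 p.11 is `{0}` (vacuity record),
# and Lemma 1's Gronwall shape (11) p.5 bounds nothing (Step 2 p.11)

D-0090 NS-CLAIMS SWEEP, refuter-8 (g0); the Step-2 toy is ns-claims-typist-8 g2's kit
(`killkit-Chebiam2025.lean` 6c9f1e0f8095c1e1), adopted with fully qualified statements.

**Statement grain (Definition 4 (9) p.2 × Theorem 6 p.11).** At `s = 1`, `p = 4` the exponent of the
double integral (9) is `3 + sp = 7 = N + p` (`N = 3`). For a `C¹` field `f` whose derivative is non-zero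
at some point of `closure Ω` (`Ω` open), the integral `∫_Ω∫_Ω |f(x) − f(y)|⁴/|x − y|⁷ dx dy` is infinite:
near that point `|f(x) − f(y)| ≥ (μ/2)|x − y|` for `x − y` in an open cone, and
`∫_{cone ∩ B_r} |h|⁻³ dh = Σ_k (dyadic shell contributions ≥ c₀ > 0) = ∞`
(`gagliardo_one_four_eq_top`; H. Brezis, «How to recognize constant functions», Russian Math. Surveys
57:4 (2002), Prop. 2, in the smooth case). Hence every datum of Theorem 6 — smooth, vanishing off the
bounded `Ω`, with (9) finite — has zero derivative everywhere and is identically zero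
(`isDatum_eq_zero`), while `0` is a datum (`isDatum_zero`): the theorem ranges over the rest datum only.

**Proof grain (Step 2 p.11, «Using Lemma 1, we know that ‖u‖_{T¹₄} remains bounded on [0,T*)»).**
At the typed grain of Lemma 1 (11) p.5 the inference is false: `T* = 1`, `C = 3`, `A = 1`, `ψ = g ≡ 0`,
`φ(t) = |1 − t|^{−1/2}` satisfy (11) on `[0,1)` with `φ` unbounded (`not_Step_2_lemma1GivesBound`).

WHAT THIS IS NOT: not a claim about NS regularity or blow-up; not a claim about any author beyond the
typed locator.
-/

noncomputable section

set_option linter.dupNamespace false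

open Set Function Filter MeasureTheory Metric
open scoped Topology ENNReal NNReal ContDiff Pointwise

namespace Summit.NavierStokesRegularity.NavierStokesRegularity.Theorems.Chebiam2025

open Literature.Claims.NS.Chebiam2025 Literature.Analysis.FluidPDE

/-! ### The smooth Brezis degeneracy of `T¹₄` -/

/-- **Brezis degeneracy, smooth case**: if `f` is `C¹` with `Df(z) ≠ 0` at a point `z ∈ closure Ω`
(`Ω` open), then `∫_Ω∫_Ω |f(x) − f(y)|⁴ / |x − y|⁷ dx dy = ∞`.
[cite: Chebiam2025, Definition 4 (9) p.2] -/
theorem gagliardo_one_four_eq_top {Ω : Set E3} (hΩ : IsOpen Ω) {f : E3 → E3} (hf : ContDiff ℝ 1 f)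
    {z : E3} (hz : z ∈ closure Ω) (hL : fderiv ℝ f z ≠ 0) :
    Literature.Claims.NS.Chebiam2025.gagliardo 1 4 Ω f = ⊤ := by
  set L := fderiv ℝ f z with hLdef
  -- a direction on which `L` does not vanish
  obtain ⟨v, hv⟩ : ∃ v, L v ≠ 0 := by
    by_contra h
    exact hL (ContinuousLinearMap.ext fun w => by simpa using not_exists.1 h w)
  have hv0 : v ≠ 0 := fun h => hv (by rw [h, map_zero])
  have hvn : 0 < ‖v‖ := norm_pos_iff.2 hv0
  have hLv : 0 < ‖L v‖ := norm_pos_iff.2 hv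
  set μ : ℝ := ‖L v‖ / (2 * ‖v‖) with hμdef
  have hμ : 0 < μ := by rw [hμdef]; positivity
  -- strict differentiability at `z`
  have hstrict : HasStrictFDerivAt f L z := hf.contDiffAt.hasStrictFDerivAt one_ne_zero
  obtain ⟨δ, hδ, hδest⟩ := Metric.eventually_nhds_iff.1 (hstrict.isLittleO.def (half_pos hμ))
  -- a ball inside `Ω ∩ B(z, δ)`
  obtain ⟨x₁, hx₁Ω, hx₁z⟩ := Metric.mem_closure_iff.1 hz (δ / 2) (half_pos hδ)
  obtain ⟨ρ₀, hρ₀, hballΩ⟩ := Metric.isOpen_iff.1 hΩ x₁ hx₁Ω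
  set ρ : ℝ := min ρ₀ (δ / 2) with hρdef
  have hρ : 0 < ρ := lt_min hρ₀ (half_pos hδ)
  have hball_Ω : ball x₁ ρ ⊆ Ω := (ball_subset_ball (min_le_left _ _)).trans hballΩ
  have hball_z : ball x₁ ρ ⊆ ball z δ := by
    intro y hy
    rw [mem_ball] at hy ⊢
    have hρ₂ : ρ ≤ δ / 2 := min_le_right _ _
    calc dist y z ≤ dist y x₁ + dist x₁ z := dist_triangle _ _ _
      _ < ρ + δ / 2 := by rw [dist_comm x₁ z]; exact add_lt_add hy hx₁z
      _ ≤ δ := by linarith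
  set r : ℝ := ρ / 4 with hrdef
  have hr : 0 < r := by rw [hrdef]; positivity
  -- the cone `U` and the dyadic shells `S k`
  set U : Set E3 := {h | μ * ‖h‖ < ‖L h‖} with hUdef
  have hUopen : IsOpen U := isOpen_lt (continuous_const.mul continuous_norm) L.continuous.norm
  have hUcone : ∀ {c : ℝ}, 0 < c → ∀ {h : E3}, h ∈ U → c • h ∈ U := by
    intro c hc h hh
    simp only [hUdef, mem_setOf_eq, map_smul, norm_smul, Real.norm_of_nonneg hc.le] at hh ⊢
    nlinarith
  have hvU : v ∈ U := by
    simp only [hUdef, mem_setOf_eq, hμdef]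
    have : ‖L v‖ / (2 * ‖v‖) * ‖v‖ = ‖L v‖ / 2 := by field_simp
    linarith
  set S : ℕ → Set E3 := fun k => U ∩ {h | r / 2 ^ (k + 1) ≤ ‖h‖ ∧ ‖h‖ < r / 2 ^ k} with hSdef
  have hSmeas : ∀ k, MeasurableSet (S k) := fun k =>
    hUopen.measurableSet.inter ((measurableSet_le measurable_const measurable_norm).inter
      (measurableSet_lt measurable_norm measurable_const))
  have hSdisj : Pairwise (Disjoint on S) := by
    intro j k hjk
    rw [Function.onFun, Set.disjoint_left]
    rintro h ⟨-, hj1, hj2⟩ ⟨-, hk1, hk2⟩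
    rcases lt_or_gt_of_ne hjk with hlt | hlt
    · have : r / 2 ^ k ≤ r / 2 ^ (j + 1) :=
        div_le_div_of_nonneg_left hr.le (by positivity) (pow_le_pow_right₀ (by norm_num) (by omega))
      linarith
    · have : r / 2 ^ j ≤ r / 2 ^ (k + 1) :=
        div_le_div_of_nonneg_left hr.le (by positivity) (pow_le_pow_right₀ (by norm_num) (by omega))
      linarith
  -- the shells are dilates of the first one
  have hSscale : ∀ k, ((2 : ℝ) ^ k)⁻¹ • S 0 ⊆ S k := by
    intro k y hy
    obtain ⟨h, ⟨hU, h1, h2⟩, rfl⟩ := Set.mem_smul_set.1 hy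
    simp only [zero_add, pow_one, pow_zero, div_one] at h1 h2
    have hc : (0 : ℝ) < ((2 : ℝ) ^ k)⁻¹ := by positivity
    refine ⟨hUcone hc hU, ?_, ?_⟩
    · rw [norm_smul, Real.norm_of_nonneg hc.le]
      have : r / 2 ^ (k + 1) = ((2 : ℝ) ^ k)⁻¹ * (r / 2) := by rw [pow_succ]; field_simp
      rw [this]
      exact mul_le_mul_of_nonneg_left h1 hc.le
    · rw [norm_smul, Real.norm_of_nonneg hc.le, div_eq_inv_mul]
      exact mul_lt_mul_of_pos_left h2 hc
  -- the first shell has positive volume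
  have hS0pos : 0 < volume (S 0) := by
    have hsub : U ∩ {h | r / 2 < ‖h‖ ∧ ‖h‖ < r} ⊆ S 0 := by
      rintro h ⟨hU, h1, h2⟩
      refine ⟨hU, ?_, ?_⟩
      · simpa using h1.le
      · simpa using h2
    have hopen : IsOpen (U ∩ {h : E3 | r / 2 < ‖h‖ ∧ ‖h‖ < r}) :=
      hUopen.inter ((isOpen_lt continuous_const continuous_norm).inter
        (isOpen_lt continuous_norm continuous_const))
    have hne : (U ∩ {h : E3 | r / 2 < ‖h‖ ∧ ‖h‖ < r}).Nonempty := by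
      have hc : (0 : ℝ) < 3 * r / (4 * ‖v‖) := by positivity
      have hnorm : ‖(3 * r / (4 * ‖v‖)) • v‖ = 3 * r / 4 := by
        rw [norm_smul, Real.norm_of_nonneg hc.le]
        field_simp
      refine ⟨(3 * r / (4 * ‖v‖)) • v, hUcone hc hvU, ?_, ?_⟩
      · show r / 2 < ‖(3 * r / (4 * ‖v‖)) • v‖
        rw [hnorm]; linarith
      · show ‖(3 * r / (4 * ‖v‖)) • v‖ < r
        rw [hnorm]; linarith
    exact (hopen.measure_pos volume hne).trans_le (measure_mono hsub)
  -- the shell constant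
  set c₀ : ℝ≥0∞ := ENNReal.ofReal ((μ / 2) ^ 4 / r ^ 3) * volume (S 0) with hc₀
  have hc₀ne : c₀ ≠ 0 :=
    mul_ne_zero (ENNReal.ofReal_pos.2 (by positivity)).ne' hS0pos.ne'
  -- the integrand
  set G : E3 → E3 → ℝ≥0∞ := fun x y => ‖f x - f y‖ₑ ^ (4 : ℝ) / ‖x - y‖ₑ ^ (3 + 1 * 4 : ℝ)
    with hG
  -- geometry: `x ∈ B(x₁, r)`, `y - x ∈ S k` puts `y` in `B(x₁, ρ)`
  have hyball : ∀ k, ∀ x ∈ ball x₁ r, ∀ y : E3, y - x ∈ S k → y ∈ ball x₁ ρ := by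
    intro k x hx y hy
    obtain ⟨-, -, h2⟩ := hy
    rw [mem_ball] at hx ⊢
    have hrk : r / 2 ^ k ≤ r := div_le_self hr.le (one_le_pow₀ (by norm_num))
    calc dist y x₁ ≤ dist y x + dist x x₁ := dist_triangle _ _ _
      _ < r / 2 ^ k + r := by rw [dist_eq_norm]; exact add_lt_add h2 hx
      _ ≤ ρ := by rw [hrdef] at hrk ⊢; linarith
  -- pointwise lower bound of the integrand on the `k`-th shell
  have hGlow : ∀ k, ∀ x ∈ ball x₁ r, ∀ y : E3, y - x ∈ S k →
      ENNReal.ofReal ((μ / 2) ^ 4 / (r / 2 ^ k) ^ 3) ≤ G x y := by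
    intro k x hx y hy
    have hyρ := hyball k x hx y hy
    obtain ⟨hU, h1, h2⟩ := hy
    set h := y - x with hh
    have hhpos : 0 < ‖h‖ := lt_of_lt_of_le (by positivity) h1
    have hxz : dist x z < δ :=
      hball_z ((ball_subset_ball (by rw [hrdef]; linarith)) hx)
    have hyz : dist y z < δ := hball_z hyρ
    have hdist : dist (x, y) (z, z) < δ := by
      rw [Prod.dist_eq]; exact max_lt hxz hyz
    have hest : ‖f x - f y - L (x - y)‖ ≤ μ / 2 * ‖x - y‖ := by
      have := hδest hdist
      exact this
    have hxy : x - y = -h := by rw [hh]; abel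
    have hnorm_xy : ‖x - y‖ = ‖h‖ := by rw [hxy, norm_neg]
    have hLxy : ‖L (x - y)‖ = ‖L h‖ := by rw [hxy, map_neg, norm_neg]
    have hlow : μ / 2 * ‖h‖ ≤ ‖f x - f y‖ := by
      have h3 : ‖L (x - y)‖ ≤ ‖f x - f y‖ + ‖f x - f y - L (x - y)‖ := by
        have := norm_sub_le (f x - f y) (f x - f y - L (x - y))
        simp only [sub_sub_cancel] at this
        exact this
      rw [hLxy] at h3
      rw [hnorm_xy] at hest
      have hU' : μ * ‖h‖ < ‖L h‖ := hU
      linarith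
    simp only [hG]
    rw [← ofReal_norm, ← ofReal_norm, hnorm_xy,
      ENNReal.ofReal_rpow_of_nonneg (norm_nonneg _) (by norm_num),
      ENNReal.ofReal_rpow_of_nonneg (norm_nonneg _) (by norm_num),
      ← ENNReal.ofReal_div_of_pos (Real.rpow_pos_of_pos hhpos _)]
    refine ENNReal.ofReal_le_ofReal ?_
    rw [show (3 + 1 * 4 : ℝ) = ((7 : ℕ) : ℝ) by norm_num, show (4 : ℝ) = ((4 : ℕ) : ℝ) by norm_num,
      Real.rpow_natCast, Real.rpow_natCast]
    have hA : (μ / 2 * ‖h‖) ^ 4 ≤ ‖f x - f y‖ ^ 4 := pow_le_pow_left₀ (by positivity) hlow 4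
    have hB : ‖h‖ ^ 3 ≤ (r / 2 ^ k) ^ 3 := pow_le_pow_left₀ hhpos.le h2.le 3
    have hh0 : ‖h‖ ≠ 0 := hhpos.ne'
    calc (μ / 2) ^ 4 / (r / 2 ^ k) ^ 3 ≤ (μ / 2) ^ 4 / ‖h‖ ^ 3 :=
          div_le_div_of_nonneg_left (by positivity) (by positivity) hB
      _ = (μ / 2 * ‖h‖) ^ 4 / ‖h‖ ^ 7 := by field_simp
      _ ≤ ‖f x - f y‖ ^ 4 / ‖h‖ ^ 7 := div_le_div_of_nonneg_right hA (by positivity)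
  -- the inner integral is infinite for every `x ∈ B(x₁, r)`
  have hinner : ∀ x ∈ ball x₁ r, ∫⁻ y in Ω, G x y = ⊤ := by
    intro x hx
    set T : ℕ → Set E3 := fun k => (fun y : E3 => y + -x) ⁻¹' S k with hT
    have hTmem : ∀ k y, y ∈ T k ↔ y - x ∈ S k := fun k y => by
      simp [hT, sub_eq_add_neg]
    have hTmeas : ∀ k, MeasurableSet (T k) := fun k => measurable_add_const (-x) (hSmeas k)
    have hTdisj : Pairwise (Disjoint on T) := fun j k hjk => (hSdisj hjk).preimage _
    have hTsub : (⋃ k, T k) ⊆ Ω := by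
      intro y hy
      obtain ⟨k, hk⟩ := mem_iUnion.1 hy
      exact hball_Ω (hyball k x hx y ((hTmem k y).1 hk))
    have hvol : ∀ k, volume (T k) = volume (S k) := fun k =>
      measure_preimage_add_right volume (-x) (S k)
    have hshell : ∀ k, c₀ ≤ ∫⁻ y in T k, G x y := by
      intro k
      have step1 : ∫⁻ _ in T k, ENNReal.ofReal ((μ / 2) ^ 4 / (r / 2 ^ k) ^ 3) ≤
          ∫⁻ y in T k, G x y :=
        lintegral_mono_ae ((ae_restrict_iff' (hTmeas k)).2
          (Eventually.of_forall fun y hy => hGlow k x hx y ((hTmem k y).1 hy)))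
      rw [setLIntegral_const, hvol k] at step1
      refine le_trans ?_ step1
      have hc : (0 : ℝ) < ((2 : ℝ) ^ k)⁻¹ := by positivity
      calc c₀ = ENNReal.ofReal ((μ / 2) ^ 4 / (r / 2 ^ k) ^ 3) *
            (ENNReal.ofReal (|(((2 : ℝ) ^ k)⁻¹) ^ Module.finrank ℝ E3|) * volume (S 0)) := by
            rw [hc₀, ← mul_assoc, ← ENNReal.ofReal_mul (by positivity), finrank_euclideanSpace_fin,
              abs_of_nonneg (by positivity)]
            congr 2
            field_simp
        _ = ENNReal.ofReal ((μ / 2) ^ 4 / (r / 2 ^ k) ^ 3) * volume (((2 : ℝ) ^ k)⁻¹ • S 0) := by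
            rw [Measure.addHaar_smul]
        _ ≤ ENNReal.ofReal ((μ / 2) ^ 4 / (r / 2 ^ k) ^ 3) * volume (S k) := by
            gcongr
            exact hSscale k
    refine top_le_iff.1 ?_
    calc (⊤ : ℝ≥0∞) = ∑' _ : ℕ, c₀ := (ENNReal.tsum_const_eq_top_of_ne_zero hc₀ne).symm
      _ ≤ ∑' k, ∫⁻ y in T k, G x y := ENNReal.tsum_le_tsum hshell
      _ = ∫⁻ y in ⋃ k, T k, G x y := (lintegral_iUnion hTmeas hTdisj _).symm
      _ ≤ ∫⁻ y in Ω, G x y := lintegral_mono_set hTsub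
  -- the outer integral over `B(x₁, r) ⊆ Ω` is then infinite
  have hXpos : 0 < volume (ball x₁ r) := measure_ball_pos volume x₁ hr
  have hXΩ : ball x₁ r ⊆ Ω := (ball_subset_ball (by rw [hrdef]; linarith)).trans hball_Ω
  change ∫⁻ x in Ω, ∫⁻ y in Ω, G x y = ⊤
  refine top_le_iff.1 ?_
  calc (⊤ : ℝ≥0∞) = ∫⁻ _ in ball x₁ r, (⊤ : ℝ≥0∞) := by
        rw [setLIntegral_const, ENNReal.top_mul hXpos.ne']
    _ ≤ ∫⁻ x in ball x₁ r, ∫⁻ y in Ω, G x y :=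
        lintegral_mono_ae ((ae_restrict_iff' measurableSet_ball).2
          (Eventually.of_forall fun x hx => (hinner x hx).symm.le))
    _ ≤ ∫⁻ x in Ω, ∫⁻ y in Ω, G x y := lintegral_mono_set hXΩ

/-- **The datum class of Theorem 6 is `{0}`**: on a bounded open `Ω ⊂ ℝ³`, a field that is smooth on
`ℝ³`, vanishes off `Ω` and has the double integral (9) (with `s = 1`, `p = 4`) finite is identically
zero. [cite: Chebiam2025, Thm 6 p.11; Definition 4 (9) p.2] -/
theorem isDatum_eq_zero {Ω : Set E3} (hΩ : IsOpen Ω) (hb : Bornology.IsBounded Ω) {u₀ : E3 → E3}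
    (h : Literature.Claims.NS.Chebiam2025.IsDatum Ω u₀) : u₀ = 0 := by
  obtain ⟨hsmooth, -, hoff, -, hfin⟩ := h
  have h1 : ContDiff ℝ 1 u₀ := contDiff_infty.1 hsmooth 1
  have hderiv0 : ∀ z, fderiv ℝ u₀ z = 0 := by
    intro z
    by_contra hz
    by_cases hcl : z ∈ closure Ω
    · exact hfin.ne (gagliardo_one_four_eq_top hΩ h1 hcl hz)
    · have hnhds : (closure Ω)ᶜ ∈ 𝓝 z := isClosed_closure.isOpen_compl.mem_nhds hcl
      have hev : u₀ =ᶠ[𝓝 z] fun _ => (0 : E3) :=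
        Filter.mem_of_superset hnhds fun y hy => hoff y fun hyΩ => hy (subset_closure hyΩ)
      exact hz (by rw [hev.fderiv_eq]; simp)
  have hconst := is_const_of_fderiv_eq_zero (h1.differentiable one_ne_zero) hderiv0
  obtain ⟨R, hR⟩ := (Metric.isBounded_iff_subset_closedBall (0 : E3)).1 hb
  set q : E3 := EuclideanSpace.single 0 (|R| + 1) with hq
  have hqn : ‖q‖ = |R| + 1 := by
    rw [hq, PiLp.norm_single, Real.norm_of_nonneg (by positivity)]
  have hqΩ : q ∉ Ω := by
    intro hqΩ
    have := hR hqΩ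
    rw [mem_closedBall, dist_zero_right, hqn] at this
    linarith [le_abs_self R]
  funext x
  rw [hconst x q, hoff q hqΩ]
  rfl

/-- The rest datum belongs to the class (so the class is exactly `{0}`).
[cite: Chebiam2025, Thm 6 p.11; Definition 4 (9) p.2] -/
theorem isDatum_zero (Ω : Set E3) : Literature.Claims.NS.Chebiam2025.IsDatum Ω 0 := by
  refine ⟨contDiff_const, fun x => by simp [VectorCalculus.divergence], fun _ _ => rfl,
    contDiff_const, ?_⟩
  have : Literature.Claims.NS.Chebiam2025.gagliardo 1 4 Ω 0 = 0 := by
    unfold Literature.Claims.NS.Chebiam2025.gagliardo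
    simp [ENNReal.zero_rpow_of_pos (by norm_num : (0 : ℝ) < 4)]
  rw [this]
  exact ENNReal.zero_lt_top

/-- **Theorem 6 p.11 quantifies over the rest datum only**: its datum hypothesis holds iff `u₀ = 0`.
[cite: Chebiam2025, Thm 6 p.11; Definition 4 (9) p.2] -/
theorem isDatum_iff_eq_zero {Ω : Set E3} (hΩ : IsOpen Ω) (hb : Bornology.IsBounded Ω)
    (u₀ : E3 → E3) : Literature.Claims.NS.Chebiam2025.IsDatum Ω u₀ ↔ u₀ = 0 :=
  ⟨isDatum_eq_zero hΩ hb, fun h => h ▸ isDatum_zero Ω⟩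

/-! ### Step 2 p.11: Lemma 1's Gronwall shape (11) bounds nothing (typist-8 g2's toy) -/

/-- The toy `T¹₄`-norm trajectory `φ₂(t) = √(|1 − t|⁻¹)`. [folklore] -/
def phi2 (t : ℝ) : ℝ := Real.sqrt (|1 - t|⁻¹)

/-- `φ₂ ≥ 0`. [folklore] -/
theorem phi2_nonneg (t : ℝ) : 0 ≤ phi2 t := Real.sqrt_nonneg _

/-- `φ₂² = |1 − t|⁻¹`. [folklore] -/
theorem phi2_sq (t : ℝ) : phi2 t ^ 2 = |1 - t|⁻¹ :=
  Real.sq_sqrt (inv_nonneg.mpr (abs_nonneg _))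

/-- `φ₂⁴ = ((1 − t)²)⁻¹`. [folklore] -/
theorem phi2_pow_four (t : ℝ) : phi2 t ^ 4 = ((1 - t) ^ 2)⁻¹ := by
  rw [show (4 : ℕ) = 2 * 2 from rfl, pow_mul, phi2_sq, inv_pow, sq_abs]

/-- `∫₀ᵗ φ₂⁴ = (1 − t)⁻¹ − 1` for `0 ≤ t < 1`. [folklore] -/
theorem integral_phi2_pow_four {t : ℝ} (ht0 : 0 ≤ t) (ht1 : t < 1) :
    ∫ s in (0 : ℝ)..t, phi2 s ^ 4 = (1 - t)⁻¹ - 1 := by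
  have hderiv : ∀ s ∈ Set.uIcc 0 t, HasDerivAt (fun s : ℝ => (1 - s)⁻¹) (((1 - s) ^ 2)⁻¹) s := by
    intro s hs
    rw [Set.uIcc_of_le ht0] at hs
    have hne : (1 - s) ≠ 0 := by linarith [hs.2]
    have h1 : HasDerivAt (fun s : ℝ => 1 - s) (-1) s := by
      simpa using (hasDerivAt_id s).const_sub (1 : ℝ)
    have h2 := h1.inv hne
    have h3 : HasDerivAt (fun s : ℝ => (1 - s)⁻¹) (-(-1 : ℝ) / (1 - s) ^ 2) s := h2
    refine h3.congr_deriv ?_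
    rw [neg_neg, one_div]
  have hcont : ContinuousOn (fun s : ℝ => ((1 - s) ^ 2)⁻¹) (Set.uIcc 0 t) := by
    rw [Set.uIcc_of_le ht0]
    refine ContinuousOn.inv₀ (by fun_prop) ?_
    intro s hs
    exact pow_ne_zero 2 (by linarith [hs.2])
  simp_rw [phi2_pow_four]
  rw [intervalIntegral.integral_eq_sub_of_hasDerivAt hderiv (hcont.intervalIntegrable)]
  simp

/-- **Step 2 p.11 at the grain of Lemma 1 (11) p.5 is false**: (11) holds on `[0,1)` for `C = 3`,
`A = 1`, `ψ = g ≡ 0` and the unbounded `φ₂`. (Toy of ns-claims-typist-8 g2.)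
[cite: Chebiam2025, Lemma 1 (11) p.5; Thm 6 proof Step 2 p.11] -/
theorem not_Step_2_lemma1GivesBound : ¬ Literature.Claims.NS.Chebiam2025.Step_2_lemma1GivesBound := by
  intro h
  have hφ4int : ∀ t ∈ Ico (0 : ℝ) 1, IntervalIntegrable (fun s => phi2 s ^ 4) volume 0 t := by
    intro t ht
    have hcont : ContinuousOn (fun s : ℝ => ((1 - s) ^ 2)⁻¹) (Set.uIcc 0 t) := by
      rw [Set.uIcc_of_le ht.1]
      refine ContinuousOn.inv₀ (by fun_prop) ?_
      intro s hs
      exact pow_ne_zero 2 (by linarith [hs.2, ht.2])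
    simp_rw [phi2_pow_four]
    exact hcont.intervalIntegrable
  have hineq : ∀ t ∈ Ico (0 : ℝ) 1,
      phi2 t ^ 2 + ∫ s in (0 : ℝ)..t, (fun _ : ℝ => (0 : ℝ)) s ≤
        3 * (1 + ∫ s in (0 : ℝ)..t, (fun _ : ℝ => (0 : ℝ)) s) *
          Real.exp (3 * ∫ s in (0 : ℝ)..t, phi2 s ^ 4) := by
    intro t ht
    rw [integral_phi2_pow_four ht.1 ht.2, phi2_sq, abs_of_pos (by linarith [ht.2])]
    simp only [intervalIntegral.integral_zero, add_zero, mul_one]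
    set r : ℝ := (1 - t)⁻¹ with hr
    have hr1 : 1 ≤ r := by
      rw [hr]
      exact one_le_inv_iff₀.mpr ⟨by linarith [ht.2], by linarith [ht.1]⟩
    have hexp : 1 + 3 * (r - 1) ≤ Real.exp (3 * (r - 1)) := by
      have := Real.add_one_le_exp (3 * (r - 1)); linarith
    nlinarith [hexp, hr1]
  obtain ⟨M, hM⟩ := h 1 3 1 phi2 (fun _ => 0) (fun _ => 0) one_pos (by norm_num) zero_le_one
    phi2_nonneg (fun _ => le_rfl) (fun _ => le_rfl) hφ4int hineq
  set K : ℝ := max M 1 + 1 with hK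
  have hK1 : 1 < K := by rw [hK]; linarith [le_max_right M 1]
  have hKpos : 0 < K := by linarith
  set t : ℝ := 1 - (K ^ 2)⁻¹ with ht
  have hK2 : 1 < K ^ 2 := by nlinarith
  have ht0 : 0 ≤ t := by
    rw [ht]; have : (K ^ 2)⁻¹ < 1 := inv_lt_one_of_one_lt₀ hK2; linarith
  have ht1 : t < 1 := by
    rw [ht]; have : (0 : ℝ) < (K ^ 2)⁻¹ := (by positivity); linarith
  have hval : phi2 t = K := by
    unfold phi2
    rw [ht, show (1 : ℝ) - (1 - (K ^ 2)⁻¹) = (K ^ 2)⁻¹ by ring, abs_of_pos (by positivity), inv_inv]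
    exact Real.sqrt_sq hKpos.le
  have := hM t ⟨ht0, ht1⟩
  rw [hval, hK] at this
  linarith [le_max_left M 1]

end Summit.NavierStokesRegularity.NavierStokesRegularity.Theorems.Chebiam2025

end
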